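import Summits.BirchSwinnertonDyer.BirchSwinnertonDyer.Theorems.ClassRecordThreeCornerAtThreeBranchesDefs
import Summits.BirchSwinnertonDyer.Rank1Residual.X11b.TwistTransportIrr
import Summits.BirchSwinnertonDyer.BirchSwinnertonDyer.Theorems.ClassRecordThreeCornerTwinLowerModEightDefs
import Summits.BirchSwinnertonDyer.BirchSwinnertonDyer.Theorems.ClassRecordThreeCornerTwistWitnessUnitTwin
import Summits.BirchSwinnertonDyer.Rank1Residual.AdditivePotMult.RankOneHeegner
import HarnessLib

/-!
# Crux `CornerAtThreeW` (item stmt-BirchSwinnertonDyer-21420; routes `ClassRecordThree` ∕ `KolyvaginRoadThree`, rung K2@3) —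
# THE (Tw)-SIDE BENEFIT CUT, file 2/2: conjunct (W) needs the main-conjecture half at ONE `d_K ≡ 1 (mod 8)` twin; the r22 stub is a
# pure weakening of the r21 stub (cell `bsd-stepL`, seat `bsd-stepL-corner3-p2` g16 = WIDTH-LEVER lane B; `--supports stmt-BirchSwinnertonDyer-21420 --as helper`)

HONEST FRAMING: THEOREMS ONLY (no definition, no named fact, no `sorry`); every theorem is CONDITIONAL on its displayed
binders; nothing here is a BSD class theorem; no census label moves (T7); item 21420 is NOT closed; none of its registered
stubs is proved here. BSD is proved for no curve.

WHY: see file 1/2 (`…CornerAtThreeUpperOfTwistKatoHalf.lean`): the line's twist pair is consumed through full `BSD(E^{(d_K)},3)` at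
EVERY twin, but conjunct (W) `CornerTwistWitness.CornerTwistWitnessAt W` needs it at ONE twin, and the mono-carrier END on odd `N` needs
only the `≥`-half at ONE `d_K ≡ 1 (mod 8)` frame (`CornerTwinHalves.CornerTwinLowerModEightAt W`, lane B g6's EXISTING typed object,
free at an exact twin, per-pair certifiable; on even `N` implied by the twin-lower supply). THIS FILE:

* §1 `missingLowerBoundAt_of_printShape_lower_rankZero` — bookkeeping converse of additive-p1's
  `exists_printShape_lower_of_missingLowerBoundAt_rankZero`: in analytic rank `0`, a rational `q = L(Wd,1)/Ω(Wd)` with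
  `ord_p q ≤ ord_p #Ш + ord_p ∏c − 2·ord_p #tors` gives `Typed.MissingLowerBoundAt Wd p` (`#Ш_an = q·#tors²/∏c`).
* §2 (W) `cornerTwistWitnessAt_of_twinLowerModEight_of_katoFacts_of_muAn` — conjunct (W) from ONE `d_K ≡ 1 (mod 8)` twin frame
  carrying the `≥`-half + the Kato half there (thirteen Kato-twin facts + the analytic `μ = 0` certificate, via mult-p3 g4's
  `CornerTwistWitness.bsdp_twin_of_muAn_of_lower`). Class level: `cornerTwistWitness3_of_twinLowerModEight_of_katoFacts_of_muAn`
  (`∀ W, CornerTwistWitnessAt W` ⟸ `CornerTwinHalves.CornerTwinLowerModEight` + thirteen facts + `CornerAtThreeTwistMuAn` —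
  `CornerAtThreeTwistLower` NOT a hypothesis).
* §3 the WEAKENING certificate `cornerTwinLowerModEight_of_twistLower3` — `CornerAtThreeTwistLower → CornerTwinHalves.CornerTwinLowerModEight`
  given newforms + Hoffstein–Luo + GZK + modularity (a `d_K ≡ 1 (mod 8)` Heegner frame with `L(E^{(d_K)},1) ≠ 0` exists by lane B g6's
  `exists_admissibleFieldModEight_of_rootNumber_eq_neg_one`; the ∀-lower bound read there, put in print shape). So the r22 stub is
  a PURE WEAKENING of the r21 stub it replaces (modulo print the line already carries).

CONSEQUENCE (the r22 TURNKEY of the line, this seat): `stub_cornerTwistLower3` ↦ `stub_cornerTwinLowerModEight3 :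
CornerTwinHalves.CornerTwinLowerModEight`; (U) via file 1/2, (W) via §2, the odd-`N` mono END reads the stub directly; stub count 7 unchanged;
both `_of` conclude the crux BY NAME. After r22 the line carries NO rank-`0` main-conjecture lower bound as a ∀-statement: what is left
of (Tw) is the analytic `μ = 0` of the twins (∀, for (U) at every frame) and ONE `≥`-half per curve at a `d_K ≡ 1 (mod 8)` frame.

References: [HoffsteinLuo1997] §1; [Kato2004Asterisque] §17.13; [Wuthrich2014] Cor. 18; [SteinWuthrich2013] Thm. 6.1; [Miller2011LMS]
Def. 1.1; [Skinner2016PacificMC] Thm. C (shape only); tree: `…CornerTwinLowerModEightDefs` (lane B g6), `…CornerTwistWitnessUnitTwin`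
(mult-p3 g4), `…CornerAtThreeBranches` (corner-p1 g6), `Rank1Residual/AdditivePotMult/RankOneHeegner` (additive-p1).
-/

set_option autoImplicit false
set_option linter.dupNamespace false

noncomputable section

open scoped Classical NumberField MatrixGroups ModularForm

open CongruenceSubgroup WeierstrassCurve NumberField IsDedekindDomain Field
  Literature.NumberTheory.EllipticCurves
  Literature.NumberTheory.EllipticCurves.ModularForms
  Literature.NumberTheory.EllipticCurves.Rank1Residual
  Literature.NumberTheory.EllipticCurves.Rank1Residual.Typed
  Literature.NumberTheory.EllipticCurves.Wuthrich2014
  Literature.NumberTheory.EllipticCurves.SteinWuthrich2013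
  Literature.NumberTheory.EllipticCurves.Greenberg1999
  Literature.NumberTheory.EllipticCurves.Kato2004
  Literature.NumberTheory.QuadraticFields.Quadratic
  Literature.NumberTheory.Automorphic
  Summit.BirchSwinnertonDyer.Rank1Residual
  Summit.BirchSwinnertonDyer.Rank1Residual.X11b
  Summit.BirchSwinnertonDyer.Rank1Residual.X11b.Three
  Summit.BirchSwinnertonDyer.BirchSwinnertonDyer.Theorems
  Summit.BirchSwinnertonDyer.BirchSwinnertonDyer.Theorems.CornerTwinHalves

namespace Summit.BirchSwinnertonDyer.BirchSwinnertonDyer.Theorems.TwistKatoHalf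

/-! ### §1 Bookkeeping: the rank-zero `≥`-half from its print shape -/

/-- **From the print shape back to the cell's `MissingLowerBoundAt`, rank `0`** (converse bookkeeping of additive-p1's
`exists_printShape_lower_of_missingLowerBoundAt_rankZero`). For a globally minimal `Wd` of analytic rank `0` with `L(Wd,1) ≠ 0`
and a rational `q = L(Wd,1)/Ω(Wd)` with `ord_p q ≤ ord_p #Ш + ord_p ∏c − 2·ord_p #tors`: `Typed.MissingLowerBoundAt Wd p`, with the
witness `#Ш_an = q·#tors²/∏c` (`L^{(0)}(1)/0! = L(1)`, `Reg = 1` by GZK in rank `0`). Elementary.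
[cite: Miller2011LMS, §1 and Def. 1.1 (arXiv:1010.2431 p. 3)] -/
theorem missingLowerBoundAt_of_printShape_lower_rankZero (Wd : WeierstrassCurve ℚ) [Wd.IsElliptic]
    [Wd.IsGloballyMinimal] (p : ℕ) [Fact p.Prime] (hGZK : rank_eq_analyticRank_of_analyticRank_le_one)
    (hr0 : Wd.analyticRank = 0) (hL1 : Wd.entireLFunction 1 ≠ 0) {q : ℚ}
    (hq : Wd.entireLFunction 1 / (Wd.realPeriodRat : ℂ) = (q : ℂ))
    (hle : padicValRat p q ≤ (padicValNat p Wd.shaOrder : ℤ) + padicValNat p Wd.tamagawaProduct -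
        2 * padicValNat p Wd.torsionOrder) :
    Typed.MissingLowerBoundAt Wd p := by
  have hrank : Wd.mordellWeilRank = 0 := by rw [(hGZK Wd (by rw [hr0]; exact zero_le_one)).1, hr0]
  have hc : 0 < Wd.tamagawaProduct := Wd.tamagawaProduct_pos_holds
  have ht : 0 < Wd.torsionOrder := Wd.torsionOrder_pos_holds
  have hΩ : (Wd.realPeriodRat : ℂ) ≠ 0 := by exact_mod_cast Wd.realPeriodRat_pos_holds.ne'
  have htC : (Wd.torsionOrder : ℂ) ≠ 0 := by exact_mod_cast ht.ne'
  have hcC : (Wd.tamagawaProduct : ℂ) ≠ 0 := by exact_mod_cast hc.ne'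
  have hL : Wd.entireLFunction 1 = (q : ℂ) * (Wd.realPeriodRat : ℂ) := by
    rw [← hq, div_mul_cancel₀ _ hΩ]
  have hq0 : q ≠ 0 := by
    rintro rfl
    exact hL1 (by rw [hL]; push_cast; ring)
  refine ⟨q * (Wd.torsionOrder : ℚ) ^ 2 / (Wd.tamagawaProduct : ℚ), ?_, ?_⟩
  · rw [shaAn_def, Wd.leadingLCoeff_eq_of_analyticRank_eq_zero hr0, Wd.regulator_eq_one_of_rank_zero hrank, hL]
    push_cast
    field_simp
  · have htq : (Wd.torsionOrder : ℚ) ≠ 0 := by exact_mod_cast ht.ne'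
    have hcq : (Wd.tamagawaProduct : ℚ) ≠ 0 := by exact_mod_cast hc.ne'
    rw [padicValRat.div (mul_ne_zero hq0 (pow_ne_zero 2 htq)) hcq, padicValRat.mul hq0 (pow_ne_zero 2 htq),
      padicValRat.pow, padicValRat.of_nat, padicValRat.of_nat]
    omega

/-! ### §2 (W) from ONE `d_K ≡ 1 (mod 8)` twin frame carrying the `≥`-half, and the Kato half there -/

/-- **Conjunct (W) `CornerTwistWitness.CornerTwistWitnessAt W` from ONE `d_K ≡ 1 (mod 8)` twin frame carrying the twin's `≥`-half**
(`CornerTwinHalves.CornerTwinLowerModEightAt W`: an odd Heegner twin frame `IsTwinFrame W K Wd Cd` — `d_K` odd, `d_K < −4`, Heegner for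
`N(E)` and for `3`, `L(E^{(d_K)},1) ≠ 0`, `Wd = Cd • E^{(d_K)}` globally minimal — with `d_K ≡ 1 (mod 8)` and `q = L(Wd,1)/Ω(Wd)` carrying
`ord₃ q ≤ ord₃ #Ш(Wd) + ord₃ ∏c(Wd) − 2·ord₃ #tors(Wd)`) **and the Kato half at the twins** (`hAn`, the analytic `μ = 0` certificate binder
of `CornerAtThreeTwistMuAn` read at `W`; thirteen facts): the `≥`-half in print shape is `Typed.MissingLowerBoundAt Wd 3` (§1; `r_an(Wd) = 0`
from `L(E^{(d_K)},1) ≠ 0`), and mult-p3 g4's `bsdp_twin_of_muAn_of_lower` closes `BSDp Wd 3` at THAT twin; the frame clauses are the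
seven conjuncts of the witness verbatim. CONDITIONAL on the supplied frame, `hAn` and the thirteen facts; nothing booked.
[cite: HoffsteinLuo1997, Theorem (§1, pp. 435–436) (frame shape)] [cite: Kato2004Asterisque, §17.13 (pp. 279–280)]
[cite: Wuthrich2014, Cor. 18 (p. 398)] [cite: Miller2011LMS, §1 and Def. 1.1] -/
theorem cornerTwistWitnessAt_of_twinLowerModEight_of_katoFacts_of_muAn
    (hJs : thm61_splitMultiplicative) (hJn : thm61_nonsplitMultiplicative)
    (hGZK : rank_eq_analyticRank_of_analyticRank_le_one) (hmod : hasEntireLFunction_rat)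
    (hpar : nonempty_modularParametrizationData)
    (hGS : ∀ (W : WeierstrassCurve ℚ) [W.IsElliptic] [W.IsGloballyMinimal] (p : ℕ) [Fact p.Prime],
      greenberg_stevens (W := W) (p := p))
    (hne : Kato2004.nonempty_iwasawaH1Data) (h12 : Kato2004.thm12_4)
    (hns : Kato2004.exists_multDivisibilityInputs_nonsplit)
    (hsp : Kato2004.exists_multDivisibilityInputs_split)
    (h15 : thm15_isTorsion_multiplicative_rat)
    (h18 : Wuthrich2014.corollary18_padicLFunction_mem_iwasawaAlgebra_multiplicative)
    (hfine : Kato2004.exists_multDivisibilityInputs_fine)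
    (W : WeierstrassCurve ℚ) [W.IsElliptic] [W.IsGloballyMinimal]
    (hT8 : CornerTwinLowerModEightAt W)
    (hAn : ∀ (K : Type) [Field K] [NumberField K]
      (Wd : WeierstrassCurve ℚ) [Wd.IsElliptic] [Wd.IsGloballyMinimal] (Cd : VariableChange ℚ),
      ClassX11b W 3 → ¬ Surj W 3 → IsImaginaryQuadratic K → Odd (NumberField.discr K) →
      SatisfiesHeegnerHypothesis (W.conductorNorm ℤ) K →
      (W.quadraticTwist (NumberField.discr K : ℚ)).entireLFunction 1 ≠ 0 →
      Cd • W.quadraticTwist (NumberField.discr K : ℚ) = Wd →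
      ∀ {N : ℕ} [NeZero N] (f : CuspForm (Gamma0 N) 2), IsNewformOf Wd f →
      ∀ (ϖ : ℚ), (ϖ : ℝ) * Wd.realPeriodRat = plusPeriod f →
      ∀ (a : ℚ_[3]) (L : PowerSeries ℚ_[3]),
        (Wd.HasSplitMultiplicativeReductionAtPrime 3 → a = 1) →
        (¬ Wd.HasSplitMultiplicativeReductionAtPrime 3 → a = -1) →
        IsMultPAdicLFunctionOf f 3 a L →
        ∃ n : ℕ, ‖PowerSeries.coeff n (PowerSeries.C ((ϖ : ℚ) : ℚ_[3]) * L)‖ = 1) :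
    CornerTwistWitness.CornerTwistWitnessAt W := by
  intro hX hnsj
  haveI : Fact (Nat.Prime 3) := ⟨Nat.prime_three⟩
  obtain ⟨K, _, _, Wd, _, _, Cd, ⟨hKq, hodd, hlt, hHN, hH3, hLt, hWd⟩, -, q, hq, hle⟩ := hT8 hX hnsj
  have hD0 : (NumberField.discr K : ℚ) ≠ 0 := by exact_mod_cast NumberField.discr_ne_zero K
  haveI hEt : (W.quadraticTwist (NumberField.discr K : ℚ)).IsElliptic := W.isElliptic_quadraticTwist hD0
  have hLt' : (W.quadraticTwist (NumberField.discr K : ℚ)).entireLFunction = Wd.entireLFunction := by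
    rw [← hWd, entireLFunction_smul]
  have hLd1 : Wd.entireLFunction 1 ≠ 0 := by rw [← hLt']; exact hLt
  have hrd : Wd.analyticRank = 0 := (Wd.analyticRank_eq_zero_iff_holds (hmod Wd)).2 hLd1
  have hlow : Typed.MissingLowerBoundAt Wd 3 :=
    missingLowerBoundAt_of_printShape_lower_rankZero Wd 3 hGZK hrd hLd1 hq hle
  have hbsd : BSDp Wd 3 :=
    CornerTwistWitness.bsdp_twin_of_muAn_of_lower hJs hJn hGZK hmod hpar hGS hne h12 hns hsp h15 h18 hfine W hX hnsj K Wd Cd hKq hHN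
      hLt hWd hlow (fun f hf ϖ hϖ a L hsa hna hL ↦ hAn K Wd Cd hX hnsj hKq hodd hHN hLt hWd f hf ϖ hϖ a L hsa hna hL)
  exact ⟨K, inferInstance, inferInstance, Wd, inferInstance, inferInstance, Cd, hKq, hodd, hlt, hHN, hH3, hLt, hWd, hbsd⟩

/-- **Class level (W): `∀ W, CornerTwistWitness.CornerTwistWitnessAt W` ⟸ {`CornerTwinHalves.CornerTwinLowerModEight` (ONE mod-8 twin
frame per corner curve carrying the `≥`-half), the thirteen Kato-twin facts, `CornerAtThreeTwistMuAn`}.** The registered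
`stub_cornerTwistLower3 : CornerAtThreeTwistLower` (the `≥`-half at EVERY twin) is NOT among the hypotheses. Bookkeeping over
`cornerTwistWitnessAt_of_twinLowerModEight_of_katoFacts_of_muAn`. CONDITIONAL; closes nothing (item 21421 `CornerTwistWitnessLeafAtThree`
stays an aside). [cite: HoffsteinLuo1997, Theorem (§1) (frame shape)] [cite: Kato2004Asterisque, §17.13 (pp. 279–280)] [cite: Miller2011LMS, Def. 1.1] -/
theorem cornerTwistWitness3_of_twinLowerModEight_of_katoFacts_of_muAn
    (hF : thm61_splitMultiplicative ∧ thm61_nonsplitMultiplicative ∧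
      rank_eq_analyticRank_of_analyticRank_le_one ∧ WeierstrassCurve.hasEntireLFunction_rat ∧
      nonempty_modularParametrizationData ∧
      (∀ (W : WeierstrassCurve ℚ) [W.IsElliptic] [W.IsGloballyMinimal] (p : ℕ) [Fact p.Prime],
        greenberg_stevens (W := W) (p := p)) ∧
      Kato2004.nonempty_iwasawaH1Data ∧ Kato2004.thm12_4 ∧
      Kato2004.exists_multDivisibilityInputs_nonsplit ∧ Kato2004.exists_multDivisibilityInputs_split ∧
      thm15_isTorsion_multiplicative_rat ∧
      Wuthrich2014.corollary18_padicLFunction_mem_iwasawaAlgebra_multiplicative ∧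
      Kato2004.exists_multDivisibilityInputs_fine)
    (hT8 : CornerTwinLowerModEight) (hμ : CornerAtThreeTwistMuAn) :
    ∀ (W : WeierstrassCurve ℚ) [W.IsElliptic] [W.IsGloballyMinimal], CornerTwistWitness.CornerTwistWitnessAt W := by
  obtain ⟨hJs, hJn, hGZK, hmod, hpar, hGS, hne, h12, hns, hsp, h15, h18, hfine⟩ := hF
  intro W _ _
  exact cornerTwistWitnessAt_of_twinLowerModEight_of_katoFacts_of_muAn hJs hJn hGZK hmod hpar hGS hne h12 hns hsp h15 h18
    hfine W (hT8 W) (fun K _ _ Wd _ _ Cd ↦ hμ W K Wd Cd)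

/-! ### §3 The weakening certificate: the r22 stub is implied by the r21 stub it replaces (modulo print) -/

/-- **`CornerAtThreeTwistLower → CornerTwinHalves.CornerTwinLowerModEight`, granted newforms (`hnf`), Hoffstein–Luo (`hHL`), GZK, modularity.**
For a corner curve: the sign is `−1` (`r_an = 1`, `hnf`), so `exists_admissibleFieldModEight_of_rootNumber_eq_neg_one` (lane B g6) supplies an
imaginary quadratic `K` with `d_K` odd, `d_K ≡ 1 (mod 8)`, `d_K < −4`, Heegner for `N(E)` and `3`, `L(E^{(d_K)},1) ≠ 0`; Néron gives a global
minimal model `Wd` of the twist; the ∀-lower bound read THERE (`Typed.MissingLowerBoundAt Wd 3`) is put in print shape by additive-p1's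
`exists_printShape_lower_of_missingLowerBoundAt_rankZero` (`Wd[3]` irreducible). So the r22 stub is a PURE WEAKENING of the r21 stub. Bookkeeping;
CONDITIONAL on the four print binders and on `hL`.
-- adapted from Summits/BirchSwinnertonDyer/BirchSwinnertonDyer/Theorems/ClassRecordThreeCornerTwinLowerModEightDefs.lean (`…_of_cornerTwistAt`)
[cite: HoffsteinLuo1997, Theorem (§1, pp. 435–436)] [cite: Skinner2016PacificMC, Thm. C (shape only)] [cite: Miller2011LMS, Def. 1.1] -/
theorem cornerTwinLowerModEight_of_twistLower3 (hnf : exists_isNewformOf)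
    (hHL : HoffsteinLuo1997_exists_twist_L_one_ne_zero)
    (hGZK : rank_eq_analyticRank_of_analyticRank_le_one) (hmod : hasEntireLFunction_rat)
    (hL : CornerAtThreeTwistLower) : CornerTwinLowerModEight := by
  intro W _ _ hX hns
  haveI : Fact (Nat.Prime 3) := ⟨Nat.prime_three⟩
  have hr : W.analyticRank = 1 := hX.1
  have hw : W.rootNumber = -1 := by
    rw [WeierstrassCurve.rootNumber_eq_neg_one_pow_analyticRank_of_exists_isNewformOf hnf W, hr]
    norm_num
  obtain ⟨K, _, _, hK, hodd, hd8, hlt, hHN, hH3, hLt⟩ :=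
    exists_admissibleFieldModEight_of_rootNumber_eq_neg_one hnf hHL W hw 3
  have hD0 : (NumberField.discr K : ℚ) ≠ 0 := by exact_mod_cast NumberField.discr_ne_zero K
  haveI hEt : (W.quadraticTwist (NumberField.discr K : ℚ)).IsElliptic := W.isElliptic_quadraticTwist hD0
  obtain ⟨Cd, hCd⟩ := hasGlobalMinimalModel_rat_holds (W.quadraticTwist (NumberField.discr K : ℚ))
  haveI := hCd
  set Wd : WeierstrassCurve ℚ := Cd • W.quadraticTwist (NumberField.discr K : ℚ) with hWd_def
  have hWd : Cd • W.quadraticTwist (NumberField.discr K : ℚ) = Wd := rfl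
  have hlow : Typed.MissingLowerBoundAt Wd 3 := hL W K Wd Cd hX hns hK hodd hHN hLt hWd
  have hLt' : (W.quadraticTwist (NumberField.discr K : ℚ)).entireLFunction = Wd.entireLFunction := by
    rw [← hWd, entireLFunction_smul]
  have hLd1 : Wd.entireLFunction 1 ≠ 0 := by rw [← hLt']; exact hLt
  have hrd : Wd.analyticRank = 0 := (Wd.analyticRank_eq_zero_iff_holds (hmod Wd)).2 hLd1
  have hirrd : Irr Wd 3 := hasIrreducibleModPGaloisRep_twist_model W 3 K hK.1 hX.2.2.2 Cd hWd
  obtain ⟨qd, hqd, hvqd⟩ :=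
    AdditivePotMult.exists_printShape_lower_of_missingLowerBoundAt_rankZero Wd hGZK hrd hirrd hlow
  exact ⟨K, inferInstance, inferInstance, Wd, inferInstance, hCd, Cd, ⟨hK, hodd, hlt, hHN, hH3, hLt, hWd⟩, hd8,
    qd, hqd, hvqd⟩

end Summit.BirchSwinnertonDyer.BirchSwinnertonDyer.Theorems.TwistKatoHalf

end
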